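import Mathlib
import Literature.NumberTheory.LFunctions.Zhang2022.Section16TwoFactorClosedForms
import Literature.NumberTheory.LFunctions.Zhang2022.Section16Varpi2TwoPart
import Literature.NumberTheory.LFunctions.Zhang2022.TypedSection16ALeaves
import HarnessLib

/-!
# Zhang (2022) §16 Lemma 16.2 (row G-d57-1): the value of the `2`-factor at `s = 1` —
# the branch `χ(2) = 0` (`2 ∣ D`), EXACTLY (WP09-PLAN §10.3 item D-2e, first part)

Topic `Literature/NumberTheory/LFunctions/Zhang2022` (Landau–Siegel audit tree; verdict-neutral).
Y. Zhang, *Discrete mean estimates and the Landau–Siegel zero*, arXiv:2211.02515v1 (2022)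
[Zhang2022LandauSiegel] — **an unrefereed manuscript under adjudication; nothing here asserts or
denies its Theorems 1–2 or anything about Landau–Siegel zeros.** ZHANG-L discharge lane, WP16
BLOCK D (Lemma 16.2; carve of record: zl-w09-p6 = "the prime 2"), item D-2e of WP09-PLAN §10.3
(signature `stub_twoFactor_value` of the planner's `SketchD2.lean`): the `2`-Euler factor of
`E₂ⱼ = (ζ²ζ(·−β_j)L L(·−β_j)²)⁻¹Σ_n ϖ₂ⱼ(n)(ν∗χ)(n)n^{−s}` at `s = 1`,
`N₂(1)·Σ_e ϖ₂ⱼ(2^e)(ν∗χ)(2^e)2^{−e}`, against the `q = 2` factor of the main term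
`(6/π²)φ(D)/(D𝔭)∏_{q∣D} q/(q+1)` (`hasProd_frakU2Main`, p480248).

THIS FILE: the branch `χ(2) = 0` (i.e. `2 ∣ D`), where the value is EXACT: `F₂(d,l;s) = 1` for all
`d, l` (`calM2Factor_eq_one_of_apply_eq_zero`, from the closed form `calM2Factor_prime_eq`), hence
`ϖ₂ⱼ(2^e) = 2^{eβ_j}` (`varpi2_two_pow_of_apply_eq_zero`), `(ν∗χ)(2^e) = 1`, and
`N₂(1)·Σ_e 2^{eβ_j}2^{−e} = (1−½)²(1−2^{β_j}/2)·(1−2^{β_j}/2)⁻¹ = (1−½)²`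
(`twoFactor_value_of_apply_eq_zero`; for large `D` under (A): `twoFactor_value_two_dvd`).
The branches `χ(2) = ±1` (error `O(α)`) are the sequel.

Theorem-only; no definitions, no new facts.

## References

* Y. Zhang, arXiv:2211.02515v1 (2022), §16 pp. 93–94, App. A p. 105.
  [cite: Zhang2022LandauSiegel, §16 Lemma 16.2 p.94]
-/

noncomputable section

open Complex Real Finset

namespace Literature.NumberTheory.LFunctions.Zhang2022.Typed.Section16B

open Literature.NumberTheory.LFunctions.Zhang2022
open Literature.NumberTheory.LFunctions.Zhang2022.Skeleton
open Literature.NumberTheory.LFunctions.Zhang2022.Typed.Section16A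

variable (c' : ℝ) {D : ℕ} (χ : DirichletCharacter ℂ D)

/-! ## `χ(q) = 0`: the Euler factor is `1` -/

/-- **`χ(q) = 0 ⇒ F_q(d,l;s) = 1` for all `d, l`** (`q` prime, `‖q^{−s}‖ < 1`): in the closed form
`calM2Factor_prime_eq`, `v = 0` gives `P = (1−wx)/(1−x)`, `Λ_d = c_d = 1`, local series `(w−1)x/(1−wx)`,
and `(1−wx)/(1−x)·(1 + (w−1)x/(1−wx)) = 1`. [cite: Zhang2022LandauSiegel, §16 p.91 (u021); App. A p.105] -/
theorem calM2Factor_eq_one_of_apply_eq_zero {q : ℕ} (hq : q.Prime) (hv : χ (q : ZMod D) = 0)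
    (d l : ℕ) (s : ℂ) (hx : ‖(q : ℂ) ^ (-s)‖ < 1) : calM2Factor c' χ q d l s = 1 := by
  rw [calM2Factor_prime_eq c' χ hq d l s hx, hv]
  obtain ⟨hw, -⟩ := AppendixA.norm_cpow_neg_beta1 c' (D := D) hq.pos
  set w : ℂ := (q : ℂ) ^ (-beta1 c' D) with hwdef
  set x : ℂ := (q : ℂ) ^ (-s) with hxdef
  have h1x : (1 : ℂ) - x ≠ 0 := by
    intro h
    have : x = 1 := by linear_combination -h
    rw [this, norm_one] at hx
    exact lt_irrefl _ hx
  have hwx : (1 : ℂ) - w * x ≠ 0 := by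
    intro h
    have h1 : w * x = 1 := by linear_combination -h
    have : ‖w * x‖ < 1 := by rw [norm_mul, hw, one_mul]; exact hx
    rw [h1, norm_one] at this
    exact lt_irrefl _ this
  have hL : (if Nat.Coprime q d then AppendixA.locLam 0 w q else 1) = 1 := by
    split_ifs <;> simp [AppendixA.locLam]
  have hC : (if Nat.Coprime q d then (1 - w * ((0 : ℂ) / q))⁻¹ else 1) = 1 := by
    split_ifs <;> simp
  rw [hL, hC]
  unfold AppendixA.locPref
  field_simp
  ring

/-- `λ₂(q^a) = 1` when `χ(q) = 0`. [cite: Zhang2022LandauSiegel, §16 p.90 (u014)] -/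
theorem lam2_prime_pow_of_apply_eq_zero {q : ℕ} (hq : q.Prime) (hv : χ (q : ZMod D) = 0)
    (a : ℕ) (s : ℂ) : lam2 c' χ (q ^ a) s = 1 := by
  rw [Lemma162R.lam2_prime_pow c' χ hq a s]
  split_ifs
  · rfl
  · rw [Typed.Section16ALeaves.lam2_prime c' χ hq s, hv]; simp

/-- `(q^e)^s = (q^s)^e` for natural `q, e`. [folklore] -/
private theorem natCast_pow_cpow (q e : ℕ) (s : ℂ) : ((q ^ e : ℕ) : ℂ) ^ s = ((q : ℂ) ^ s) ^ e := by
  induction e with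
  | zero => simp
  | succ n ih => rw [pow_succ, Nat.cast_mul, Complex.natCast_mul_natCast_cpow, ih, pow_succ]

/-! ## `χ(2) = 0`: `ϖ₂ⱼ(2^e) = 2^{eβ_j}` and the value of the `2`-factor -/

/-- **`χ(2) = 0 ⇒ ϖ₂ⱼ(2^e) = (2^{β_j})^e`** (given `𝓜₂*(1−β_j) ≠ 0`): in the closed form D-2b only the
divisor pair `(2^e, 1)` survives (`χ(2^b) = 0` for `b ≥ 1`), with `λ₂(2^e) = 1`, `F₂ ≡ 1 = F*₂`.
[cite: Zhang2022LandauSiegel, §16 p.93 (u030)] -/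
theorem varpi2_two_pow_of_apply_eq_zero (hv : χ (2 : ZMod D) = 0) (j : ℕ)
    (hstar : calM2star c' χ (1 - betaJ c' D j) ≠ 0) (e : ℕ) :
    varpi2 c' χ j (2 ^ e) = ((2 : ℂ) ^ betaJ c' D j) ^ e := by
  classical
  set s : ℂ := 1 - betaJ c' D j with hs
  have hx : ‖((2 : ℕ) : ℂ) ^ (-s)‖ < 1 := by
    rw [Complex.norm_natCast_cpow_of_pos (by norm_num : 0 < 2)]
    have : (-s).re = -1 := by simp [hs, betaJ_re_eq_zero c' D j]
    rw [this]; norm_num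
  have hv' : χ ((2 : ℕ) : ZMod D) = 0 := by exact_mod_cast hv
  have hF1 : ∀ d l : ℕ, calM2Factor c' χ 2 d l s = 1 :=
    fun d l => calM2Factor_eq_one_of_apply_eq_zero c' χ Nat.prime_two hv' d l s hx
  have hne : χ (2 : ZMod D) ≠ 1 := by rw [hv]; exact zero_ne_one
  have hF : χ (2 : ZMod D) ≠ 1 → calM2Factor c' χ 2 1 1 s ≠ 0 := fun _ => by
    rw [hF1]; exact one_ne_zero
  rw [varpi2_two_pow c' χ j e hstar hF, if_pos hne, hF1, inv_one, one_mul,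
    Nat.sum_divisorsAntidiagonal (f := fun d l => lam2 c' χ d 1 * (d : ℂ) ^ betaJ c' D j *
      χ (l : ZMod D) * calM2Factor c' χ 2 d l s),
    Nat.divisors_prime_pow Nat.prime_two, Finset.sum_map]
  simp only [Function.Embedding.coeFn_mk]
  rw [Finset.sum_eq_single_of_mem e (Finset.mem_range.mpr (Nat.lt_succ_self e))]
  · rw [Nat.div_self (pow_pos (by norm_num) e), Nat.cast_one, map_one, hF1,
      lam2_prime_pow_of_apply_eq_zero c' χ Nat.prime_two hv' e, natCast_pow_cpow]
    push_cast
    ring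
  · intro a ha hae
    have hae' : a < e := lt_of_le_of_ne (Nat.lt_succ_iff.mp (Finset.mem_range.mp ha)) hae
    have hdiv : 2 ^ e / 2 ^ a = 2 ^ (e - a) := Nat.pow_div hae'.le (by norm_num)
    have hχ : χ ((2 ^ e / 2 ^ a : ℕ) : ZMod D) = 0 := by
      rw [hdiv, Nat.cast_pow, map_pow, hv', zero_pow (by omega)]
    rw [hχ]; ring

/-- **The value of the `2`-factor when `χ(2) = 0`, EXACTLY** (given `𝓜₂*(1−β_j) ≠ 0`):
`N₂(1)·Σ_e ϖ₂ⱼ(2^e)(ν∗χ)(2^e)2^{−e} = (1 − ½)²` — the `q = 2` factor of `hasProd_frakU2Main` for `2 ∣ D`.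
[cite: Zhang2022LandauSiegel, §16 Lemma 16.2 p.94; App. A p.105] -/
theorem twoFactor_value_of_apply_eq_zero (hv : χ (2 : ZMod D) = 0) (j : ℕ)
    (hstar : calM2star c' χ (1 - betaJ c' D j) ≠ 0) :
    ((1 - (2 : ℂ) ^ (-(1 : ℂ))) ^ 2 * (1 - (2 : ℂ) ^ betaJ c' D j * (2 : ℂ) ^ (-(1 : ℂ))) *
          (1 - χ (2 : ZMod D) * (2 : ℂ) ^ (-(1 : ℂ))) *
            (1 - χ (2 : ZMod D) * ((2 : ℂ) ^ betaJ c' D j * (2 : ℂ) ^ (-(1 : ℂ)))) ^ 2) *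
        (∑' e : ℕ, varpi2 c' χ j (2 ^ e) * nuConvChi χ (2 ^ e) * ((2 : ℂ) ^ (-(1 : ℂ))) ^ e) =
      (1 - (2 : ℂ)⁻¹) ^ 2 := by
  set z : ℂ := (2 : ℂ) ^ betaJ c' D j with hz
  have hznorm : ‖z‖ = 1 := by
    rw [hz, show (2 : ℂ) = ((2 : ℕ) : ℂ) by norm_num,
      Complex.norm_natCast_cpow_of_pos (by norm_num : 0 < 2), betaJ_re_eq_zero c' D j, Real.rpow_zero]
  have h2inv : (2 : ℂ) ^ (-(1 : ℂ)) = (2 : ℂ)⁻¹ := Complex.cpow_neg_one 2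
  have hv' : χ ((2 : ℕ) : ZMod D) = 0 := by exact_mod_cast hv
  have hterm : ∀ e : ℕ, varpi2 c' χ j (2 ^ e) * nuConvChi χ (2 ^ e) * ((2 : ℂ) ^ (-(1 : ℂ))) ^ e =
      (z * (2 : ℂ)⁻¹) ^ e := by
    intro e
    rw [varpi2_two_pow_of_apply_eq_zero c' χ hv j hstar e,
      Lemma162R.nuConvChi_prime_pow_of_apply_eq_zero χ Nat.prime_two hv' e, h2inv, mul_one, ← mul_pow]
  have hr : ‖z * (2 : ℂ)⁻¹‖ < 1 := by
    rw [norm_mul, hznorm, one_mul, norm_inv, Complex.norm_ofNat]; norm_num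
  have hsum : (∑' e : ℕ, varpi2 c' χ j (2 ^ e) * nuConvChi χ (2 ^ e) * ((2 : ℂ) ^ (-(1 : ℂ))) ^ e) =
      (1 - z * (2 : ℂ)⁻¹)⁻¹ := by
    rw [tsum_congr hterm, tsum_geometric_of_norm_lt_one hr]
  have hne : (1 : ℂ) - z * (2 : ℂ)⁻¹ ≠ 0 := by
    intro h
    have h1 : z * (2 : ℂ)⁻¹ = 1 := by linear_combination -h
    rw [h1, norm_one] at hr
    exact lt_irrefl _ hr
  have hne2 : (2 : ℂ) - z ≠ 0 := by
    intro h
    apply hne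
    have : z = 2 := by linear_combination -h
    rw [this]; norm_num
  rw [hsum, hv, h2inv]
  field_simp
  ring

/-- `χ(q) = 0` for a prime `q ∣ D`. [folklore] -/
private theorem chi_eq_zero_of_dvd' {q : ℕ} (hq : q.Prime) (hqD : q ∣ D) : χ (q : ZMod D) = 0 := by
  apply χ.map_nonunit
  rw [ZMod.isUnit_iff_coprime]
  intro hcop
  have h1 : q ∣ Nat.gcd q D := Nat.dvd_gcd dvd_rfl hqD
  rw [hcop] at h1
  exact hq.one_lt.ne' (Nat.dvd_one.mp h1)

/-- **D-2e, branch `2 ∣ D`** (large `D` under (A), `j ∈ {1,2}`): the `2`-factor of `E₂ⱼ` at `s = 1`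
EQUALS the `2`-factor `(1−½)²` of the main term — so the `O(α)` bound of `stub_twoFactor_value` holds there
with any `K ≥ 0`. [cite: Zhang2022LandauSiegel, §16 Lemma 16.2 p.94] -/
theorem twoFactor_value_two_dvd : ForAllLarge fun D _ χ => AssumptionA D χ → 2 ∣ D →
    ∀ j ∈ ({1, 2} : Finset ℕ),
      ((1 - (2 : ℂ) ^ (-(1 : ℂ))) ^ 2 * (1 - (2 : ℂ) ^ betaJ c' D j * (2 : ℂ) ^ (-(1 : ℂ))) *
            (1 - χ (2 : ZMod D) * (2 : ℂ) ^ (-(1 : ℂ))) *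
              (1 - χ (2 : ZMod D) * ((2 : ℂ) ^ betaJ c' D j * (2 : ℂ) ^ (-(1 : ℂ)))) ^ 2) *
          (∑' e : ℕ, varpi2 c' χ j (2 ^ e) * nuConvChi χ (2 ^ e) * ((2 : ℂ) ^ (-(1 : ℂ))) ^ e) =
        (1 - (2 : ℂ)⁻¹) ^ 2 := by
  obtain ⟨D₁, hD₁⟩ := two_data_ne_zero c'
  refine ForAllLarge.of_le D₁ fun D _ χ hD hq hprim hA h2 j hj => ?_
  obtain ⟨hstar, -⟩ := hD₁ D χ hD hq hprim hA j hj
  have hv : χ (2 : ZMod D) = 0 := by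
    have := chi_eq_zero_of_dvd' χ Nat.prime_two h2
    exact_mod_cast this
  exact twoFactor_value_of_apply_eq_zero c' χ hv j hstar

end Literature.NumberTheory.LFunctions.Zhang2022.Typed.Section16B

end
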